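import Mathlib
import Literature.Analysis.Complex.LaplaceHalfLine
import Summits.AnomalousDissipation.AnomalousDissipation.Theorems.SoloBlindHardyFromDecay
import Summits.AnomalousDissipation.AnomalousDissipation.Theorems.SoloBlindResolventReadout

/-!
# Solo-blind kernel #273 — the analytic half of [A′](a), assembled: plain box bounds ⇒ mass bound

One theorem composing kernels #269 (resolvent read-out: plain bound ⇒ units, inverse bound, envelope,
holomorphy), #267 (strip envelope ⇒ Hardy H²) and #266 (H² + `𝓛k = R` ⇒ the shifted-line mass bound).

INPUT (exactly what ENGINE L / LEMMA P and the structural Laplace identity deliver, ENGINE-L-SPEC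
§13, §15): a complete normed `ℂ`-algebra `A`; `L, src : ℂ → A` holomorphic on the open strip
`a < Re s < b`; the PLAIN BOUND `‖L(σ+iy)‖ ≤ q < 1` for `a < σ ≤ b`, all `y` (box verdicts + cover,
#272); a SOURCE ENVELOPE `‖src(σ+iy)‖ ≤ C₀/√(1+y²)` there (#271); a causal kernel `k` of exponential
order `γ < b` (#270) with `𝓛k = R := ℓ((1 − L)⁻¹ src)` on `Re s > max γ a`.
OUTPUT (`Aprime_mass_le_of_plain`): for `γ₂ > 0` and `a < −(γε + γ₂)`,
`∫₀^∞ ‖k‖ e^{γε t} dt ≤ √( (2π)⁻¹ ∫ ‖R(−(γε+γ₂) + iω)‖² dω / (2γ₂) )` — the [A′](a) inequality whose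
right-hand side is the certified line integral `Q0′`.  Also recorded: `readout_differentiableOn_halfPlane`
(R is holomorphic on the whole half-plane `Re s > a`: by units on the strip, by `𝓛k` beyond `γ`).
-/

namespace Summit.AnomalousDissipation.SoloBlind.AprimeAssembly

open Complex Set MeasureTheory Literature.Analysis.Complex
open Summit.AnomalousDissipation.SoloBlind.ResolventReadout
open scoped Real

variable {A : Type*} [NormedRing A] [NormedAlgebra ℂ A] [CompleteSpace A] [NormOneClass A]

/-- **Holomorphy of the read-out on the half-plane `Re s > a`**: on the strip `a < Re s < b` from the
plain bound (units, #269), on `Re s > γ` from `R = 𝓛k` (#270 / Literature `differentiableOn_laplaceC`);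
`γ < b` glues the two open pieces. -/
theorem readout_differentiableOn_halfPlane {L src : ℂ → A} (ℓ : A →L[ℂ] ℂ) {k : ℝ → ℂ}
    {K γ a b q : ℝ} (hk : HalfLineExpBound k K γ) (hγb : γ < b)
    (hL : DifferentiableOn ℂ L {s : ℂ | a < s.re ∧ s.re < b})
    (hsrc : DifferentiableOn ℂ src {s : ℂ | a < s.re ∧ s.re < b}) (hq : q < 1)
    (hplain : ∀ σ y : ℝ, a < σ → σ ≤ b → ‖L (σ + y * I)‖ ≤ q)
    (hFk : ∀ s : ℂ, γ < s.re → a < s.re → readout L src ℓ s = laplaceC k s) :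
    DifferentiableOn ℂ (readout L src ℓ) {s : ℂ | a < s.re} := by
  have hstrip_open : IsOpen {s : ℂ | a < s.re ∧ s.re < b} :=
    (isOpen_lt continuous_const Complex.continuous_re).inter
      (isOpen_lt Complex.continuous_re continuous_const)
  have hhalf_open : IsOpen {s : ℂ | max γ a < s.re} := isOpen_lt continuous_const Complex.continuous_re
  -- units on the open strip
  have hunit : ∀ s ∈ {s : ℂ | a < s.re ∧ s.re < b}, IsUnit (1 - L s) := by
    intro s hs
    have h := (strip_data_of_plain hq hplain).1 s.re s.im hs.1 hs.2.le
    simpa [Complex.re_add_im] using h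
  have hRstrip : DifferentiableOn ℂ (readout L src ℓ) {s : ℂ | a < s.re ∧ s.re < b} :=
    differentiableOn_readout ℓ hL hsrc hunit
  -- 𝓛k on the half-plane beyond max γ a
  have hLap : DifferentiableOn ℂ (laplaceC k) {s : ℂ | γ < s.re} := hk.differentiableOn_laplaceC
  intro s hs
  by_cases hsb : s.re < b
  · have hmem : s ∈ {s : ℂ | a < s.re ∧ s.re < b} := ⟨hs, hsb⟩
    exact ((hRstrip s hmem).differentiableAt (hstrip_open.mem_nhds hmem)).differentiableWithinAt
  · push Not at hsb
    have hγs : γ < s.re := lt_of_lt_of_le hγb hsb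
    have hmem : s ∈ {s : ℂ | max γ a < s.re} := max_lt hγs hs
    -- readout = laplaceC near s
    have heq : readout L src ℓ =ᶠ[nhds s] laplaceC k := by
      filter_upwards [hhalf_open.mem_nhds hmem] with z hz
      exact hFk z (lt_of_le_of_lt (le_max_left _ _) hz) (lt_of_le_of_lt (le_max_right _ _) hz)
    have hdiff : DifferentiableAt ℂ (laplaceC k) s :=
      (hLap s hγs).differentiableAt ((isOpen_lt continuous_const Complex.continuous_re).mem_nhds hγs)
    exact (heq.differentiableAt_iff.2 hdiff).differentiableWithinAt

/-- **[A′](a) from plain bounds** (the assembled analytic half).  See the module docstring. -/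
theorem Aprime_mass_le_of_plain {L src : ℂ → A} (ℓ : A →L[ℂ] ℂ) {k : ℝ → ℂ}
    {K γ a b q C₀ : ℝ} (hk : HalfLineExpBound k K γ) (hγb : γ < b)
    (hL : DifferentiableOn ℂ L {s : ℂ | a < s.re ∧ s.re < b})
    (hsrc : DifferentiableOn ℂ src {s : ℂ | a < s.re ∧ s.re < b}) (hq : q < 1)
    (hplain : ∀ σ y : ℝ, a < σ → σ ≤ b → ‖L (σ + y * I)‖ ≤ q)
    (hC₀ : ∀ σ y : ℝ, a < σ → σ ≤ b → ‖src (σ + y * I)‖ ≤ C₀ / Real.sqrt (1 + y ^ 2))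
    (hFk : ∀ s : ℂ, γ < s.re → a < s.re → readout L src ℓ s = laplaceC k s)
    {γε γ₂ : ℝ} (hγ₂ : 0 < γ₂) (ha : a < -(γε + γ₂)) :
    ∫ t in Ioi (0 : ℝ), ‖k t‖ * Real.exp (γε * t)
      ≤ Real.sqrt (((2 * π)⁻¹ *
          ∫ ω : ℝ, ‖readout L src ℓ ((-(γε + γ₂) : ℝ) + ω * I)‖ ^ 2) / (2 * γ₂)) := by
  -- envelope on the strip from the plain bound (#269)
  obtain ⟨_, hB⟩ := strip_data_of_plain (A := A) hq hplain
  have hB0 : 0 ≤ (1 - q)⁻¹ := by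
    have : q < 1 := hq
    exact inv_nonneg.2 (by linarith)
  have hC := strip_envelope (src := src) ℓ hB0 hB hC₀
  -- holomorphy on the half-plane
  have hF := readout_differentiableOn_halfPlane ℓ hk hγb hL hsrc hq hplain hFk
  exact HardyFromDecay.Aprime_mass_le_of_strip_decay hk hγb hF hFk hC hγ₂ ha

end Summit.AnomalousDissipation.SoloBlind.AprimeAssembly
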